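import Literature.Analysis.FunctionSpaces.PVFunctions
import HarnessLib

/-!
# A toolkit of `PV`-definable (Cobham-class) functions

Topic `Literature/Analysis/FunctionSpaces` (companion of `PVFunctions.lean`).  Closure properties of
Cobham's class `𝓛` of functions — here `IsPVDefinable`, the functions denoted by Cook's `PV` symbols
`PVFun` under their standard interpretation `PVFun.eval` — that are used in the proof of Buss's
Main Theorem `isPVDefinable_iff_isSigmabDefinable` (the witnessing direction extracts `PV` symbols
for Skolem functions, characteristic functions of sharply bounded formulas, bounded search and
sequence (de)coding).  Everything is proved *semantically*: a closure property is a statement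
`IsPVDefinable F → … → IsPVDefinable (…)` about functions `(Fin n → ℕ) → ℕ`, obtained from the two
generating operations of the class, composition (`IsPVDefinable.comp`) and limited recursion on
notation (`IsPVDefinable.of_recN`, the semantic form of the constructor `PVFun.limRec`), exactly as in
the classical development of Cobham's class (Cobham 1965; Rose 1984, Ch. 3; Buss 1986, Ch. 1,
closure of `□ᵖ₁` under sharply bounded quantification and minimisation; Cook 1975, §2, the first
derived functions of `PV`).

## Main results (all `theorem`s; no named facts)

* arithmetic and case distinction: constants, projections, `+`, `·`, `sᵢ`, `⌊·/2⌋`, `|·|`, `#`,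
  `cond`, and `IsPVDefinable.recN` (limited recursion on notation, semantic form `recN`);
* `mod2`, shifting right by a length `⌊x / 2^{|r|}⌋` (`shiftLen`) and by a number `⌊x / 2ⁱ⌋`
  (`IsPVDefinable.shiftRight`, via the truncated power of two `min 2ⁱ 2^{|x|+1}` computed by repeated
  squaring), bits, `x mod 2^{|r|}`, the ones' complement below `|r|`;
* comparison `χ_≤`, `χ_=`, truncated subtraction `∸` (by the two's-complement identity
  `y + (2^{|r|} - 1 - x) + 1 = 2^{|r|} + (y - x)`), `x mod 2ⁱ`, definition by cases on `≤`/`=`;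
* (in the companion file `PVToolkitBounded.lean`: sharply bounded quantification and minimisation,
  fixed-width sequence digits and the collecting function).

## References

* A. Cobham, *The intrinsic computational difficulty of functions*, 1965.
* S. A. Cook, *Feasibly constructive proofs and the propositional calculus*, STOC 1975, §2.
* H. E. Rose, *Subrecursion: functions and hierarchies*, OUP 1984, Ch. 3.
* S. R. Buss, *Bounded Arithmetic*, Bibliopolis 1986, Ch. 1 (the closure properties of `□ᵖ₁`).

## Design choices

* Semantic closure lemmas rather than named symbols: users obtain a symbol by
  `obtain ⟨f, hf⟩ := (h : IsPVDefinable F)`; all identities needed later are identities of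
  functions on `ℕ`, available for `f.eval` by rewriting with `hf`.
* Recursions are on the notation of a *ruler* argument `r` (only `|r|` matters), processing bit
  positions `0, 1, …, |r| - 1` in increasing order (`Nat.binaryRec`), so that invariants are
  statements about `x mod 2^{|r|}`.
-/

namespace Literature.Analysis.FunctionSpaces

open PVFun

variable {n m : ℕ}

/-! ## Plumbing: congruence, constants, projections, composition with a vector of functions -/

namespace IsPVDefinable

/-- `IsPVDefinable` is extensional. [folklore] -/
theorem of_eq {F G : (Fin n → ℕ) → ℕ} (hF : IsPVDefinable F) (h : ∀ x, F x = G x) :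
    IsPVDefinable G := by
  obtain ⟨f, rfl⟩ := hF
  exact ⟨f, funext h⟩

/-- Projections are in Cobham's class (Cobham 1965). [cite: Cobham1965] -/
theorem proj (i : Fin n) : IsPVDefinable fun x : Fin n → ℕ => x i :=
  ⟨PVFun.proj i, funext fun _ => rfl⟩

/-- Constants are in Cobham's class: `c` is a composition of `sᵢ`'s applied to `0`
(Cobham 1965; Cook 1975, §2, dyadic numerals). [cite: Cook1975, §2] -/
theorem const (c : ℕ) : IsPVDefinable fun _ : Fin n → ℕ => c := by
  induction c using Nat.binaryRec with
  | zero => exact ⟨PVFun.comp PVFun.zero ![], funext fun _ => rfl⟩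
  | bit b c ih =>
    obtain ⟨f, hf⟩ := ih
    refine ⟨PVFun.comp (PVFun.bit b) ![f], funext fun x => ?_⟩
    simp [hf]

/-- Composition with a vector of definable functions (restatement of `IsPVDefinable.comp` with the
inner functions bundled as `w x : Fin m → ℕ`) (Cobham 1965). [cite: Cobham1965] -/
theorem compVec {F : (Fin m → ℕ) → ℕ} {w : (Fin n → ℕ) → Fin m → ℕ} (hF : IsPVDefinable F)
    (hw : ∀ i, IsPVDefinable fun x => w x i) : IsPVDefinable fun x => F (w x) :=
  hF.comp (G := fun i x => w x i) hw

/-- The coordinates of `Fin.snoc (w x) (a x)` are definable when those of `w` and `a` are.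
[folklore] -/
theorem snoc_coord {w : (Fin n → ℕ) → Fin m → ℕ} {a : (Fin n → ℕ) → ℕ}
    (hw : ∀ i, IsPVDefinable fun x => w x i) (ha : IsPVDefinable a) (i : Fin (m + 1)) :
    IsPVDefinable fun x => (Fin.snoc (α := fun _ => ℕ) (w x) (a x) : Fin (m + 1) → ℕ) i := by
  cases i using Fin.lastCases with
  | last => exact ha.of_eq fun x => by simp
  | cast j => exact (hw j).of_eq fun x => by simp

/-- The coordinates of `Fin.init x` are definable. [folklore] -/
theorem init_coord (i : Fin n) :
    IsPVDefinable fun x : Fin (n + 1) → ℕ => (Fin.init x : Fin n → ℕ) i :=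
  (proj i.castSucc).of_eq fun _ => rfl

/-! ## The initial functions, pointwise -/

variable {F G H : (Fin n → ℕ) → ℕ}

/-- Cobham's class is closed under `+` (Buss 1986, §1; initial symbol of `PV` here). [cite: Buss1986, Ch. 1] -/
theorem add (hF : IsPVDefinable F) (hG : IsPVDefinable G) : IsPVDefinable fun x => F x + G x :=
  (PVFun.add.isPVDefinable_eval.comp (G := ![F, G]) (fun i => by fin_cases i <;> simpa)).of_eq
    fun x => by simp

/-- Cobham's class is closed under `·`. [cite: Buss1986, Ch. 1] -/
theorem mul (hF : IsPVDefinable F) (hG : IsPVDefinable G) : IsPVDefinable fun x => F x * G x :=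
  (PVFun.mul.isPVDefinable_eval.comp (G := ![F, G]) (fun i => by fin_cases i <;> simpa)).of_eq
    fun x => by simp

/-- Cobham's class is closed under the binary successors `x ↦ 2x + b`. [cite: Cobham1965] -/
theorem bit (b : Bool) (hF : IsPVDefinable F) : IsPVDefinable fun x => Nat.bit b (F x) :=
  ((PVFun.bit b).isPVDefinable_eval.comp (G := ![F]) (fun i => by fin_cases i; simpa)).of_eq
    fun x => by simp

/-- Cobham's class is closed under `⌊·/2⌋`. [cite: Cook1975, §2] -/
theorem half (hF : IsPVDefinable F) : IsPVDefinable fun x => F x / 2 :=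
  (PVFun.half.isPVDefinable_eval.comp (G := ![F]) (fun i => by fin_cases i; simpa)).of_eq
    fun x => by simp

/-- Cobham's class is closed under the length function `|·|`. [cite: Buss1986, Ch. 1] -/
theorem len (hF : IsPVDefinable F) : IsPVDefinable fun x => Nat.size (F x) :=
  (PVFun.len.isPVDefinable_eval.comp (G := ![F]) (fun i => by fin_cases i; simpa)).of_eq
    fun x => by simp

/-- Cobham's class is closed under smash `2^(|x|·|y|)`. [cite: Buss1986, Ch. 1] -/
theorem smash (hF : IsPVDefinable F) (hG : IsPVDefinable G) :
    IsPVDefinable fun x => 2 ^ (Nat.size (F x) * Nat.size (G x)) :=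
  (PVFun.smash.isPVDefinable_eval.comp (G := ![F, G]) (fun i => by fin_cases i <;> simpa)).of_eq
    fun x => by simp

/-- Cobham's class is closed under the conditional `if F = 0 then G else H` (Cobham 1965;
Buss 1986, Ch. 1: definition by cases). [cite: Cobham1965] -/
theorem cond (hF : IsPVDefinable F) (hG : IsPVDefinable G) (hH : IsPVDefinable H) :
    IsPVDefinable fun x => if F x = 0 then G x else H x :=
  (PVFun.cond.isPVDefinable_eval.comp (G := ![F, G, H])
    (fun i => by fin_cases i <;> simpa)).of_eq fun x => by simp

/-- Successor. [cite: Buss1986, §2.2] -/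
theorem succ (hF : IsPVDefinable F) : IsPVDefinable fun x => F x + 1 :=
  hF.add (const 1)

/-- Predecessor (Cook 1975, §2). [cite: Cook1975, §2] -/
theorem pred (hF : IsPVDefinable F) : IsPVDefinable fun x => F x - 1 :=
  (PVFun.pred.isPVDefinable_eval.comp (G := ![F]) (fun i => by fin_cases i; simpa)).of_eq
    fun x => by simp [eval_pred]

/-- The co-signum `x ↦ [x = 0]` (Rose 1984, Ch. 3). [cite: Rose1984, Ch. 3] -/
theorem sg (hF : IsPVDefinable F) : IsPVDefinable fun x => if F x = 0 then 1 else 0 :=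
  hF.cond (const 1) (const 0)

/-- The power of two `2^{|F|} = 1 # F`. [cite: Buss1986, §2.2] -/
theorem pow_len (hF : IsPVDefinable F) : IsPVDefinable fun x => 2 ^ Nat.size (F x) :=
  ((const 1).smash hF).of_eq fun x => by simp

end IsPVDefinable

/-! ## Limited recursion on notation, semantic form -/

/-- **Limited recursion on notation**, semantically and curried: the function `f(x⃗, y)` with
`f(x⃗, 0) = min (base x⃗) (bound x⃗ 0)` and, for `sᵦ y ≠ 0`,
`f(x⃗, sᵦ y) = min (step b x⃗ y (f(x⃗, y))) (bound x⃗ (sᵦ y))` (Cobham 1965; Cook 1975, §2). This is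
`PVFun.eval (limRec g h k)` when `base, step, bound` are the interpretations of `g, h, k`
(`recN_eq_eval_limRec`). [cite: Cobham1965] -/
def recN (base : (Fin n → ℕ) → ℕ) (step : Bool → (Fin n → ℕ) → ℕ → ℕ → ℕ)
    (bound : (Fin n → ℕ) → ℕ → ℕ) (x : Fin n → ℕ) : ℕ → ℕ :=
  Nat.binaryRec (motive := fun _ => ℕ) (min (base x) (bound x 0))
    (fun b y r => min (step b x y r) (bound x (Nat.bit b y)))

section RecN

variable (base : (Fin n → ℕ) → ℕ) (step : Bool → (Fin n → ℕ) → ℕ → ℕ → ℕ)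
  (bound : (Fin n → ℕ) → ℕ → ℕ)

/-- Base case of `recN`. [cite: Cobham1965] -/
@[simp] theorem recN_zero (x : Fin n → ℕ) : recN base step bound x 0 = min (base x) (bound x 0) := by
  simp [recN]

/-- Step of `recN` at `sᵦ y ≠ 0`. [cite: Cobham1965] -/
theorem recN_bit (x : Fin n → ℕ) (b : Bool) (y : ℕ) (hy : y = 0 → b = true) :
    recN base step bound x (Nat.bit b y) =
      min (step b x y (recN base step bound x y)) (bound x (Nat.bit b y)) := by
  unfold recN
  rw [Nat.binaryRec_eq _ _ (Or.inr hy)]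

/-- `recN` is bounded by its bound. [cite: Cobham1965] -/
theorem recN_le_bound (x : Fin n → ℕ) (y : ℕ) : recN base step bound x y ≤ bound x y := by
  induction y using Nat.binaryRec' with
  | zero => simp
  | bit b y hy _ => rw [recN_bit _ _ _ _ _ _ hy]; exact min_le_right _ _

/-- The interpretation of `limRec g h k` is `recN` of the interpretations. [cite: Cook1975, §2] -/
theorem recN_eq_eval_limRec (g : PVFun n) (h : Bool → PVFun (n + 2)) (k : PVFun (n + 1))
    (x : Fin n → ℕ) (y : ℕ) :
    (PVFun.limRec g h k).eval (Fin.snoc x y) =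
      recN g.eval (fun b x y r => (h b).eval (Fin.snoc (Fin.snoc x y) r))
        (fun x y => k.eval (Fin.snoc x y)) x y := by
  simp only [eval_limRec, Fin.init_snoc, Fin.snoc_last, recN]

variable {base step bound}

/-- **Cobham's class is closed under limited recursion on notation** (semantic form of the
constructor `PVFun.limRec`): if `base`, the two step functions (as functions of the vector
`(x⃗, y, r)`) and the bound (as a function of `(x⃗, y)`) are definable, so is
`(x⃗, y) ↦ recN base step bound x⃗ y` (Cobham 1965; Cook 1975, §2). [cite: Cobham1965] -/
theorem IsPVDefinable.of_recN (hbase : IsPVDefinable base)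
    (hstep : ∀ b, IsPVDefinable fun v : Fin (n + 2) → ℕ =>
      step b (Fin.init (Fin.init v)) (v (Fin.last n).castSucc) (v (Fin.last (n + 1))))
    (hbound : IsPVDefinable fun v : Fin (n + 1) → ℕ => bound (Fin.init v) (v (Fin.last n))) :
    IsPVDefinable fun v : Fin (n + 1) → ℕ => recN base step bound (Fin.init v) (v (Fin.last n)) := by
  obtain ⟨g, hg⟩ := hbase
  choose h hh using hstep
  obtain ⟨k, hk⟩ := hbound
  refine ⟨PVFun.limRec g h k, funext fun v => ?_⟩
  conv_lhs => rw [← Fin.snoc_init_self v]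
  rw [recN_eq_eval_limRec]
  congr 1
  · funext b x y r
    rw [hh b]
    simp
  · funext x y
    rw [hk]
    simp

end RecN

/-! ## Parity, shifting right by a length, the low part and the ones' complement below a length -/

section Bits

variable {F G A B : (Fin n → ℕ) → ℕ}

/-- In the step of a recursion on notation the new notation `sᵦ y` is nonzero. [folklore] -/
theorem bit_ne_zero_of_imp {b : Bool} {y : ℕ} (hy : y = 0 → b = true) : Nat.bit b y ≠ 0 := by
  rcases eq_or_ne y 0 with rfl | h
  · simp [hy rfl]
  · exact Nat.bit_ne_zero b h

/-- `|sᵦ y| = |y| + 1` in the step of a recursion on notation (Buss 1986, §2.2, axiom 10).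
[cite: Buss1986, §2.2] -/
theorem size_bit_of_imp {b : Bool} {y : ℕ} (hy : y = 0 → b = true) :
    (Nat.bit b y).size = y.size + 1 :=
  Nat.size_bit (bit_ne_zero_of_imp hy)

/-- `x mod 2` by recursion on notation: `0 mod 2 = 0`, `(sᵦ y) mod 2 = b` (Cook 1975, §2,
among the first derived functions of `PV`). [cite: Cook1975, §2] -/
theorem recN_mod_two (x : Fin 0 → ℕ) (y : ℕ) :
    recN (fun _ => 0) (fun b _ _ _ => b.toNat) (fun _ _ => 1) x y = y % 2 := by
  induction y using Nat.binaryRec' with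
  | zero => simp
  | bit b y hy _ =>
    rw [recN_bit _ _ _ _ _ _ hy, Nat.bit_val]
    cases b <;> simp [Nat.add_mod]

/-- Cobham's class is closed under `x ↦ x mod 2` (Cook 1975, §2). [cite: Cook1975, §2] -/
theorem IsPVDefinable.mod_two (hF : IsPVDefinable F) : IsPVDefinable fun x => F x % 2 := by
  have h1 : IsPVDefinable fun v : Fin 1 → ℕ => v 0 % 2 := by
    refine (IsPVDefinable.of_recN (n := 0) (base := fun _ => 0) (step := fun b _ _ _ => b.toNat)
      (bound := fun _ _ => 1) (.const 0) (fun b => .const _) (.const 1)).of_eq fun v => ?_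
    rw [recN_mod_two]
    rfl
  exact (h1.compVec (w := fun x => ![F x]) (fun i => by fin_cases i; simpa)).of_eq fun x => by
    simp

/-- `⌊x / 2^{|r|}⌋` by recursion on the notation of the ruler `r`, halving at each step
(Cook 1975, §2: iterated `TR`; Buss 1986, §2.4, `MSP`). [cite: Cook1975, §2] -/
theorem recN_shiftLen (x : Fin 1 → ℕ) (y : ℕ) :
    recN (fun x => x 0) (fun _ _ _ r => r / 2) (fun x _ => x 0) x y = x 0 / 2 ^ y.size := by
  induction y using Nat.binaryRec' with
  | zero => simp
  | bit b y hy ih =>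
    rw [recN_bit _ _ _ _ _ _ hy, ih, size_bit_of_imp hy, Nat.pow_succ, ← Nat.div_div_eq_div_mul]
    exact min_eq_left ((Nat.div_le_self _ _).trans (Nat.div_le_self _ _))

/-- Cobham's class is closed under shifting right by a length, `⌊F / 2^{|G|}⌋` (Cook 1975, §2;
Buss 1986, §2.4, `MSP`). [cite: Cook1975, §2] -/
theorem IsPVDefinable.shiftLen (hF : IsPVDefinable F) (hG : IsPVDefinable G) :
    IsPVDefinable fun x => F x / 2 ^ (G x).size := by
  have h2 : IsPVDefinable fun v : Fin 2 → ℕ => v 0 / 2 ^ (v 1).size := by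
    refine (IsPVDefinable.of_recN (n := 1) (base := fun x => x 0) (step := fun _ _ _ r => r / 2)
      (bound := fun x _ => x 0) (.proj 0) (fun _ => (IsPVDefinable.proj (Fin.last 2)).half)
      ((IsPVDefinable.proj 0).of_eq fun _ => rfl)).of_eq fun v => ?_
    rw [recN_shiftLen]
    rfl
  exact (h2.compVec (w := fun x => ![F x, G x]) (fun i => by fin_cases i <;> simpa)).of_eq
    fun x => by simp

/-- Cobham's class is closed under the bit `⌊F / 2^{|G|}⌋ mod 2` at a length position
(Buss 1986, §2.4, `Bit`). [cite: Buss1986, §2.4] -/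
theorem IsPVDefinable.bitLen (hF : IsPVDefinable F) (hG : IsPVDefinable G) :
    IsPVDefinable fun x => F x / 2 ^ (G x).size % 2 :=
  (hF.shiftLen hG).mod_two

/-- `x mod 2^{|r|}` by recursion on the notation of `r`, copying the bits of `x` below `|r|`
(Buss 1986, §2.4, `LSP`). [cite: Buss1986, §2.4] -/
theorem recN_lowLen (x : Fin 1 → ℕ) (y : ℕ) :
    recN (fun _ => 0) (fun _ x y r => r + x 0 / 2 ^ y.size % 2 * 2 ^ y.size) (fun x _ => x 0) x y =
      x 0 % 2 ^ y.size := by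
  induction y using Nat.binaryRec' with
  | zero => simp [Nat.mod_one]
  | bit b y hy ih =>
    rw [recN_bit _ _ _ _ _ _ hy, ih, size_bit_of_imp hy]
    have h : x 0 % 2 ^ y.size + x 0 / 2 ^ y.size % 2 * 2 ^ y.size = x 0 % 2 ^ (y.size + 1) := by
      rw [Nat.mod_pow_succ, mul_comm]
    rw [h]
    exact min_eq_left (Nat.mod_le _ _)

/-- Cobham's class is closed under the low part `F mod 2^{|G|}` (Buss 1986, §2.4, `LSP`).
[cite: Buss1986, §2.4] -/
theorem IsPVDefinable.lowLen (hF : IsPVDefinable F) (hG : IsPVDefinable G) :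
    IsPVDefinable fun x => F x % 2 ^ (G x).size := by
  have h2 : IsPVDefinable fun v : Fin 2 → ℕ => v 0 % 2 ^ (v 1).size := by
    refine (IsPVDefinable.of_recN (n := 1) (base := fun _ => 0)
      (step := fun _ x y r => r + x 0 / 2 ^ y.size % 2 * 2 ^ y.size) (bound := fun x _ => x 0)
      (.const 0) (fun _ => ?_) ((IsPVDefinable.proj 0).of_eq fun _ => rfl)).of_eq fun v => ?_
    · exact (IsPVDefinable.proj (Fin.last 2)).add
        (((IsPVDefinable.proj 0).bitLen (.proj 1)).mul ((IsPVDefinable.proj 1).pow_len))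
    · rw [recN_lowLen]
      rfl
  exact (h2.compVec (w := fun x => ![F x, G x]) (fun i => by fin_cases i <;> simpa)).of_eq
    fun x => by simp

/-- The ones' complement of `x` below `|r|`, `2^{|r|} - 1 - (x mod 2^{|r|})`, by recursion on the
notation of `r` (a bounded, subtraction-free description; cf. Cook 1975, §2). [cite: Cook1975, §2] -/
theorem recN_complLen (x : Fin 1 → ℕ) (y : ℕ) :
    recN (fun _ => 0) (fun _ x y r => r + if x 0 / 2 ^ y.size % 2 = 0 then 2 ^ y.size else 0)
      (fun _ y => 2 ^ y.size) x y = 2 ^ y.size - 1 - x 0 % 2 ^ y.size := by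
  induction y using Nat.binaryRec' with
  | zero => simp
  | bit b y hy ih =>
    rw [recN_bit _ _ _ _ _ _ hy, ih, size_bit_of_imp hy, Nat.mod_pow_succ, Nat.pow_succ]
    have h1 : x 0 % 2 ^ y.size < 2 ^ y.size := Nat.mod_lt _ (by positivity)
    obtain hd | hd : x 0 / 2 ^ y.size % 2 = 0 ∨ x 0 / 2 ^ y.size % 2 = 1 := by omega
    · rw [hd, if_pos rfl, mul_zero, add_zero]
      omega
    · rw [hd, if_neg one_ne_zero, mul_one, add_zero]
      omega

/-- Cobham's class is closed under the ones' complement below a length,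
`2^{|G|} - 1 - (F mod 2^{|G|})`. [cite: Cook1975, §2] -/
theorem IsPVDefinable.complLen (hF : IsPVDefinable F) (hG : IsPVDefinable G) :
    IsPVDefinable fun x => 2 ^ (G x).size - 1 - F x % 2 ^ (G x).size := by
  have h2 : IsPVDefinable fun v : Fin 2 → ℕ => 2 ^ (v 1).size - 1 - v 0 % 2 ^ (v 1).size := by
    refine (IsPVDefinable.of_recN (n := 1) (base := fun _ => 0)
      (step := fun _ x y r => r + if x 0 / 2 ^ y.size % 2 = 0 then 2 ^ y.size else 0)
      (bound := fun _ y => 2 ^ y.size)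
      (.const 0) (fun _ => ?_) ((IsPVDefinable.proj (Fin.last 1)).pow_len)).of_eq fun v => ?_
    · exact (IsPVDefinable.proj (Fin.last 2)).add
        (((IsPVDefinable.proj 0).bitLen (.proj 1)).cond ((IsPVDefinable.proj 1).pow_len)
          (.const 0))
    · rw [recN_complLen]
      rfl
  exact (h2.compVec (w := fun x => ![F x, G x]) (fun i => by fin_cases i <;> simpa)).of_eq
    fun x => by simp

end Bits

/-! ## Comparison and truncated subtraction -/

section Compare

variable {F G A B : (Fin n → ℕ) → ℕ}

/-- The two's-complement comparison identity: with `K = 2^{|a+b|}` (so `a, b < K`),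
`⌊(b + (K - 1 - a mod K) + 1) / K⌋ mod 2 = [a ≤ b]`. [folklore] -/
theorem le_test_eq (a b : ℕ) :
    (b + (2 ^ (a + b).size - 1 - a % 2 ^ (a + b).size) + 1) / 2 ^ (a + b).size % 2 =
      if a ≤ b then 1 else 0 := by
  set K := 2 ^ (a + b).size with hK
  have hab : a + b < K := Nat.lt_size_self _
  have hKpos : 0 < K := by positivity
  rw [Nat.mod_eq_of_lt (show a < K by omega)]
  split_ifs with h
  · have hs : b + (K - 1 - a) + 1 = (b - a) + K := by omega
    rw [hs, Nat.add_div_right _ hKpos, Nat.div_eq_of_lt (show b - a < K by omega)]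
  · rw [Nat.div_eq_of_lt (show b + (K - 1 - a) + 1 < K by omega)]

/-- The two's-complement subtraction identity: with `K = 2^{|a+b|}`, if `a ≤ b` then
`(b + (K - 1 - a mod K) + 1) mod K = b - a`. [folklore] -/
theorem tsub_eq_ite (a b : ℕ) :
    b - a = if a ≤ b then (b + (2 ^ (a + b).size - 1 - a % 2 ^ (a + b).size) + 1) %
      2 ^ (a + b).size else 0 := by
  set K := 2 ^ (a + b).size with hK
  have hab : a + b < K := Nat.lt_size_self _
  rw [Nat.mod_eq_of_lt (show a < K by omega)]
  split_ifs with h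
  · have hs : b + (K - 1 - a) + 1 = (b - a) + K := by omega
    rw [hs, Nat.add_mod_right, Nat.mod_eq_of_lt (show b - a < K by omega)]
  · omega

/-- **Comparison is in Cobham's class**: the characteristic function `[F ≤ G]`
(Cobham 1965; Cook 1975, §2, `LESS`; Buss 1986, Ch. 1). [cite: Cook1975, §2] -/
theorem IsPVDefinable.leTest (hF : IsPVDefinable F) (hG : IsPVDefinable G) :
    IsPVDefinable fun x => if F x ≤ G x then 1 else 0 :=
  (((hG.add (hF.complLen (hF.add hG))).succ).bitLen (hF.add hG)).of_eq fun x => le_test_eq (F x) (G x)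

/-- **Definition by cases on a comparison** stays in Cobham's class (Cobham 1965; Buss 1986,
Ch. 1). [cite: Cobham1965] -/
theorem IsPVDefinable.ite_le (hF : IsPVDefinable F) (hG : IsPVDefinable G) (hA : IsPVDefinable A)
    (hB : IsPVDefinable B) : IsPVDefinable fun x => if F x ≤ G x then A x else B x :=
  ((hF.leTest hG).cond hB hA).of_eq fun x => by by_cases h : F x ≤ G x <;> simp [h]

/-- Definition by cases on a strict comparison. [cite: Cobham1965] -/
theorem IsPVDefinable.ite_lt (hF : IsPVDefinable F) (hG : IsPVDefinable G) (hA : IsPVDefinable A)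
    (hB : IsPVDefinable B) : IsPVDefinable fun x => if F x < G x then A x else B x :=
  (hG.ite_le hF hB hA).of_eq fun x => by
    by_cases h : F x < G x
    · simp [h, not_le.2 h]
    · simp [h, not_lt.1 h]

/-- Definition by cases on an equality test. [cite: Cobham1965] -/
theorem IsPVDefinable.ite_eq (hF : IsPVDefinable F) (hG : IsPVDefinable G) (hA : IsPVDefinable A)
    (hB : IsPVDefinable B) : IsPVDefinable fun x => if F x = G x then A x else B x :=
  (hF.ite_le hG (hG.ite_le hF hA hB) hB).of_eq fun x => by
    by_cases h : F x = G x
    · simp [h]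
    · by_cases h' : F x ≤ G x
      · simp [h, h', not_le.2 (lt_of_le_of_ne h' h)]
      · simp [h, h']

/-- The characteristic function of `=` is in Cobham's class. [cite: Cook1975, §2] -/
theorem IsPVDefinable.eqTest (hF : IsPVDefinable F) (hG : IsPVDefinable G) :
    IsPVDefinable fun x => if F x = G x then 1 else 0 :=
  hF.ite_eq hG (.const 1) (.const 0)

/-- The characteristic function of `<` is in Cobham's class. [cite: Cook1975, §2] -/
theorem IsPVDefinable.ltTest (hF : IsPVDefinable F) (hG : IsPVDefinable G) :
    IsPVDefinable fun x => if F x < G x then 1 else 0 :=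
  hF.ite_lt hG (.const 1) (.const 0)

/-- **Truncated subtraction is in Cobham's class** (Cook 1975, §2, `x ∸ y` among the derived
functions of `PV`; Buss 1986, §2.4). [cite: Cook1975, §2] -/
theorem IsPVDefinable.sub (hF : IsPVDefinable F) (hG : IsPVDefinable G) :
    IsPVDefinable fun x => F x - G x :=
  (hG.ite_le hF (((hF.add (hG.complLen (hG.add hF))).succ).lowLen (hG.add hF)) (.const 0)).of_eq
    fun x => (tsub_eq_ite (G x) (F x)).symm

/-- `min` is in Cobham's class. [cite: Cobham1965] -/
theorem IsPVDefinable.inf (hF : IsPVDefinable F) (hG : IsPVDefinable G) :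
    IsPVDefinable fun x => min (F x) (G x) :=
  (hF.ite_le hG hF hG).of_eq fun x => (min_def (F x) (G x)).symm

/-- `max` is in Cobham's class. [cite: Cobham1965] -/
theorem IsPVDefinable.sup (hF : IsPVDefinable F) (hG : IsPVDefinable G) :
    IsPVDefinable fun x => max (F x) (G x) :=
  (hF.ite_le hG hG hF).of_eq fun x => (max_def (F x) (G x)).symm

end Compare

/-! ## Powers of two truncated at a length; shifting and reducing by a *number* of bits -/

section Shift

variable {F G : (Fin n → ℕ) → ℕ}

/-- `|2ʲ - 1| = j`. [folklore] -/
theorem size_two_pow_sub_one (j : ℕ) : (2 ^ j - 1).size = j := by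
  refine le_antisymm (Nat.size_le.2 (Nat.sub_one_lt (by positivity))) ?_
  rcases j with _ | j
  · simp
  · exact Nat.lt_size.2 (by rw [Nat.pow_succ]; omega)

/-- The truncated power of two `min 2ᵐ 2^{|w|+1}` by recursion on the notation of `m` (repeated
squaring, truncated by the bound `2^{|w|+1} = 2·(1 # w)`): the standard way of producing, inside
Cobham's class, a ruler of prescribed length `m` when `m ≤ |w| + 1` (cf. Buss 1986, §2.4–2.5:
`2^{min(i,|a|)}` is `Σᵇ₁`-definable / polynomial time). [cite: Buss1986, §2.4] -/
theorem recN_powTrunc (x : Fin 1 → ℕ) (m : ℕ) :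
    recN (fun _ => 1) (fun b _ _ r => r * r * 2 ^ b.toNat) (fun x _ => 2 * 2 ^ (x 0).size) x m =
      min (2 ^ m) (2 * 2 ^ (x 0).size) := by
  induction m using Nat.binaryRec' with
  | zero =>
    rw [recN_zero, pow_zero]
  | bit b m hy ih =>
    rw [recN_bit _ _ _ _ _ _ hy, ih]
    set B := 2 * 2 ^ (x 0).size with hB
    have hpow : 2 ^ Nat.bit b m = 2 ^ m * 2 ^ m * 2 ^ b.toNat := by
      rw [Nat.bit_val, pow_add, two_mul, pow_add]
    rw [hpow]
    rcases le_total (2 ^ m) B with h | h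
    · rw [min_eq_left h]
    · rw [min_eq_right h]
      have hB1 : 1 ≤ B := by rw [hB, ← pow_succ']; exact Nat.one_le_two_pow
      have h1 : B ≤ B * B * 2 ^ b.toNat :=
        calc B = B * 1 * 1 := by ring
          _ ≤ B * B * 2 ^ b.toNat := by gcongr; exact Nat.one_le_two_pow
      have h2 : B ≤ 2 ^ m * 2 ^ m * 2 ^ b.toNat :=
        calc B = B * 1 * 1 := by ring
          _ ≤ 2 ^ m * 2 ^ m * 2 ^ b.toNat := by
            gcongr
            · exact Nat.one_le_two_pow
            · exact Nat.one_le_two_pow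
      rw [min_eq_right h1, min_eq_right h2]

/-- Cobham's class contains `(w, m) ↦ min 2ᵐ 2^{|w|+1}`. [cite: Buss1986, §2.4] -/
theorem IsPVDefinable.powTrunc (hF : IsPVDefinable F) (hG : IsPVDefinable G) :
    IsPVDefinable fun x => min (2 ^ G x) (2 * 2 ^ (F x).size) := by
  have h2 : IsPVDefinable fun v : Fin 2 → ℕ => min (2 ^ v 1) (2 * 2 ^ (v 0).size) := by
    refine (IsPVDefinable.of_recN (n := 1) (base := fun _ => 1)
      (step := fun b _ _ r => r * r * 2 ^ b.toNat) (bound := fun x _ => 2 * 2 ^ (x 0).size)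
      (.const 1) (fun b => ?_) ?_).of_eq fun v => ?_
    · exact ((IsPVDefinable.proj (Fin.last 2)).mul (.proj (Fin.last 2))).mul (.const _)
    · exact ((IsPVDefinable.const 2).mul ((IsPVDefinable.proj 0).pow_len)).of_eq fun v => rfl
    · rw [recN_powTrunc]
      rfl
  exact (h2.compVec (w := fun x => ![F x, G x]) (fun i => by fin_cases i <;> simpa)).of_eq
    fun x => by simp

/-- The ruler `min 2ᵐ 2^{|w|+1} - 1` has length `min m (|w| + 1)`. [folklore] -/
theorem size_powTrunc_sub_one (w m : ℕ) :
    (min (2 ^ m) (2 * 2 ^ w.size) - 1).size = min m (w.size + 1) := by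
  rw [← pow_succ']
  rcases le_total m (w.size + 1) with h | h
  · rw [min_eq_left (Nat.pow_le_pow_right two_pos h), min_eq_left h, size_two_pow_sub_one]
  · rw [min_eq_right (Nat.pow_le_pow_right two_pos h), min_eq_right h, size_two_pow_sub_one]

/-- `⌊w / 2^{min m (|w|+1)}⌋ = ⌊w / 2ᵐ⌋`. [folklore] -/
theorem div_two_pow_min_size_succ (w m : ℕ) : w / 2 ^ min m (w.size + 1) = w / 2 ^ m := by
  rcases le_total m (w.size + 1) with h | h
  · rw [min_eq_left h]
  · rw [min_eq_right h]
    have hw : w < 2 ^ (w.size + 1) := w.lt_size_self.trans (Nat.pow_lt_pow_right one_lt_two (by omega))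
    rw [Nat.div_eq_of_lt hw, Nat.div_eq_of_lt (hw.trans_le (Nat.pow_le_pow_right two_pos h))]

/-- `w mod 2^{min m (|w|+1)} = w mod 2ᵐ`. [folklore] -/
theorem mod_two_pow_min_size_succ (w m : ℕ) : w % 2 ^ min m (w.size + 1) = w % 2 ^ m := by
  rcases le_total m (w.size + 1) with h | h
  · rw [min_eq_left h]
  · rw [min_eq_right h]
    have hw : w < 2 ^ (w.size + 1) := w.lt_size_self.trans (Nat.pow_lt_pow_right one_lt_two (by omega))
    rw [Nat.mod_eq_of_lt hw, Nat.mod_eq_of_lt (hw.trans_le (Nat.pow_le_pow_right two_pos h))]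

/-- **Cobham's class is closed under shifting right by a number of bits**, `⌊F / 2^G⌋`
(Buss 1986, §2.4–2.5: `MSP(a, i) = ⌊a/2ⁱ⌋` is polynomial time / `Σᵇ₁`-definable). The shift is by
the length of the ruler `min 2^G 2^{|F|+1} - 1`. [cite: Buss1986, §2.4] -/
theorem IsPVDefinable.shiftRight (hF : IsPVDefinable F) (hG : IsPVDefinable G) :
    IsPVDefinable fun x => F x / 2 ^ G x :=
  (hF.shiftLen ((hF.powTrunc hG).pred)).of_eq fun x => by
    simp only [size_powTrunc_sub_one, div_two_pow_min_size_succ]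

/-- **Cobham's class is closed under reduction modulo a power of two**, `F mod 2^G`
(Buss 1986, §2.4–2.5, `LSP`). [cite: Buss1986, §2.4] -/
theorem IsPVDefinable.modPow (hF : IsPVDefinable F) (hG : IsPVDefinable G) :
    IsPVDefinable fun x => F x % 2 ^ G x :=
  (hF.lowLen ((hF.powTrunc hG).pred)).of_eq fun x => by
    simp only [size_powTrunc_sub_one, mod_two_pow_min_size_succ]

/-- Cobham's class is closed under the bit `⌊F / 2^G⌋ mod 2` at a numeric position
(Buss 1986, §2.4, `Bit(i, a)`). [cite: Buss1986, §2.4] -/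
theorem IsPVDefinable.testBit (hF : IsPVDefinable F) (hG : IsPVDefinable G) :
    IsPVDefinable fun x => F x / 2 ^ G x % 2 :=
  (hF.shiftRight hG).mod_two

end Shift

end Literature.Analysis.FunctionSpaces
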